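import Summits.Schanuel.Schanuel.Theorems.RootDecomp1KSectorTheorem04

/-!
# RootDecomp1KSectorTheorem — lens 1, generation 67, NODE 27 «THE SECTOR THEOREM BY ONE NEWTON STEP AT (∞,∞) — THE EDGE ENGINE» — FORK (B): the FIRST-ORDER SECTOR THEOREM at FLOOR F (`thinFibreAt_of_sectorCond : c k ≠ 0 → DomZero k c → SectorCond m₀ k c → ThinFibreAt m₀ (xPolyP k c)`, every m₀ / k / monomial support, the only escape the typed residue `Residue m₀ k c`; one PROVED Diophantine input `Ridout.padicRoth_int`; CLAIM L3031, PRICE L3032, ADDENDUM L3037, RULE K-R58, NODE L3047, VERDICT L3050) — continuation (RootDecomp1KSectorTheorem05): §8  Assembly: the size regime, the denominator of the rescaled point, THE SECTOR THEOREM — 4 declarations `pair_levels_finite` … `den_rescaled_le`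

(lens-1 g67 NODE 27 «THE SECTOR THEOREM BY ONE NEWTON STEP AT (∞,∞) — THE EDGE ENGINE» L3047: HOME kernel K = HOME/decomp-schanuel-lens-1/g67/lean/SectorTheorem.lean sha256 bbe43d14…, 2869 l, ONE namespace `Summit.Schanuel.Schanuel.Theorems.RootDecomp1KSectorTheorem`, imports the tree port …RootDecomp1KDigitPincer03 ONLY (node 26's record port; its closure holds every cell file used); no private / instance / set_option / notation / sorry / new axiom / binder / `decide` on levels; lens farm rc 0 · 0 errors · 0 sorries · warnings dupNamespace only, `--axioms` standard on the 18 deciding declarations, Probe rc 0 (g67/out/); memo g67/NODE-g67.md; CLAIM L3031 (ASK-FIRST under K-R57 (iii)); crit g12 PRICE L3032 (fork (A) ×0-AS-RECORD as posted / fork (B) a kernel meeting FLOOR F = «FIRST-ORDER SECTOR THEOREM» = THEOREM ×1 consuming K-R57 (iii); CHECKLIST K-g67 F1–F6 + S1–S8; RULE K-R58 PRE-ANNOUNCED) and PRICE ADDENDUM L3037 ((F6′) `W4P` by tree name; the ρ3 specimen `x² + x·Y² + Y⁵ + 3` of writer NOTE 17 L3036 = the F5 exhibit); census instruments LIVENESS-v36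 (key edge) / v37 (key ls2); crit g12 VERDICT L3050 (2026-09-02T03:35Z): THEOREM ×1 GRANTED under K-R57 (iii) for FORK (B) = the FIRST-ORDER SECTOR THEOREM AT FLOOR F (F1 F2 F3 (T) F4(α) F4(β) F5 F6 F6′ R-27-i and CHECKLIST S1–S8 met on the critic's own farm runs), the single ×1 of the sector line CONSUMED (K-R58 (i): no further ×1 on this line), TALLY lens-1 ×22 + THEOREM ×24, RULE K-R58 FIXED (PRICE L3032 (i)–(v) verbatim with the ADDENDUM L3037 gloss; W-27-2 = a ×0 wish for typed stratum predicates), PORT GO → census-1 (this port; PORT IDENTITY 27 owed by the seated critic). Port by census-1 gen 25 as `RootDecomp1KSectorTheorem01–10` (files ≤ 400 lines; `--supports stmt-Schanuel-33364`, the item stays OPEN; no census credit carried; RULE K-R58 (iv): UNCONDITIONAL PART ∪= these names): 01 = K l.1–307 of the prepped source (opens §1 / §2 / §3) — 20 decls `dMax`, `box`, `supp`, …, `two_zpow_inj`; 02 = K l.308–570 of the prepped source (opens §4) — 5 decls `far_pair`, `natDegree_le_dMax`, `norm_pow_sub_one_le`, …, `mem_supp`; 03 = K l.571–896 of the prepped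 source (opens §4b / §5) — 12 decls `layered_bound`, `edge_bound_one`, `edge_bound_crude`, …, `tendsto_partialSum_two`; 04 = K l.897–1221 of the prepped source (opens §6 / §7) — 10 decls `arch_finite`, `ridout_two`, `lt_rpow_neg_of_pow_mul_pow_lt`, …, `factorial_pred_le_div`; 05 = K l.1222–1500 of the prepped source (opens §8) — 4 decls `pair_levels_finite`, `dvd_lc_pow_val`, `den_le_of_dvd`, `den_rescaled_le`; 06 = K l.1501–1822 of the prepped source (opens §9) — 13 decls `size_regime`, `c_zero_ne_zero`, `far_levels_finite`, …, `sum_range_ite_shift`; 07 = K l.1823–2080 of the prepped source (inside §9) — 14 decls `layerPoly_lin2`, `layer0_lin2`, `layer1_lin2`, …, `natDegree_scaleShift`; 08 = K l.2081–2401 of the prepped source (opens §10) — 18 decls `thinFibreAt_xLinear`, `thinFibreAt_xPolyP_one`, `edgeGood_of_gap`, …, `thinFibreAt_M_sector`; 09 = K l.2402–2627 of the prepped source (opens §11) — 17 decls `sectorCond_beta0_example`, `thinFibreAt_beta0_example`, `thinFibreAt_generic_xLinear_example`, …, `rho2_two`; 10 = K l.2628–2905 of the prepped source (opens §12) — 13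 decls `residue_rho2`, `rho3`, `rho3_zero`, …, `W4P_eq`. 39 one-line docstrings synthesised for undocumented helper declarations (statements quoted, census port convention since gen 22); everything else = K VERBATIM (statements, names, proofs, K's module docstring kept in part 01 below this provenance block).)
-/

noncomputable section

namespace Summit.Schanuel.Schanuel.Theorems.RootDecomp1KSectorTheorem

open Polynomial LiouvilleNumber
open scoped Nat
open Summit.Schanuel.Schanuel.Theorems.RootDecomp1KTwoBaseCell (psNumer partialSum_eq_psNumer_div coprime_psNumer)
open Summit.Schanuel.Schanuel.Theorems.RootDecomp1KRelLiouvilleCell (partialSum_two_strictMono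
  abs_liouvilleNumber_two_sub_partialSum)
open Summit.Schanuel.Schanuel.Theorems.RootDecomp1KDegreeLadder
open Summit.Schanuel.Schanuel.Theorems.RootDecomp1KXLinear (xLinP bev_xLinP norm_ratCast_two norm_ratCast_of_le
  norm_psNumer_sub_one)
open Summit.Schanuel.Schanuel.Theorems.RootDecomp1KDigitPincer (xc XP X6P)
open Summit.Schanuel.Schanuel.Theorems.RootDecomp1KOddEmpty (W4P w4C vG natDegree_vG)
open Summit.Schanuel.Schanuel.Theorems.RootDecomp1KHyperellipticSiegel (mQ mC mC_zero mC_one mC_two natDegree_mQ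
  coeff_mQ_five leadingCoeff_mQ)
open Summit.Schanuel.Schanuel.Theorems.RootDecomp1KXLinearII (norm_aeval_le norm_psNumer)
open Summit.Schanuel.Schanuel.Theorems.RootDecomp1KXTop
open Summit.Schanuel.Schanuel.Theorems.RootDecomp1KXAll
open Summit.Schanuel.Schanuel.Theorems.RootDecomp1KLevelFinite
open Summit.Schanuel.Schanuel.Theorems.RootDecomp1KLocalExponent
open Summit.Schanuel.Schanuel.Theorems.RootDecomp1KIntegrality

/-- **THE EDGE ENGINE.**  If the slope `s/q` is good (`EdgeGood`), then for all bounds `0 < Rlo`, `R`, `C`, `Dn` the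
set of levels `N` carrying a level point `r` of `xPolyP k c` whose rescaling `W = r·2^{s·(N!/q)} ≠ 0` has
`Rlo ≤ ‖W‖₂ ≤ R`, `den W ≤ Dn`, `|W| ≤ C·2^{s·(N!/q)}` is FINITE.  Chain: edge bound (§4, depth 1) ⟹ `W` is
`2`-adically close to a root `β` of the edge polynomial (`nearest_root_sharp`) ⟹ `β = 0`: impossible (`‖W‖ ≥ Rlo`);
`β ∉ ℚ₂`: closed range; (C) crude: the layered bound at depth `L` + RIDOUT (§6/§7) with exponent `μ`; (R) refined:
the layers vanishing at the simple root `β` are ABSORBED (`refined_root` + Lipschitz), distance `2^{−L·n}`, RIDOUT with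
exponent `1`; the finitely many exceptional `W` are excluded archimedeanly (§5). -/
theorem pair_levels_finite (k : ℕ) (c : ℕ → ℤ[X]) (hB : c k ≠ 0) {s q : ℕ} (hs : 0 < s) (hq : 0 < q)
    (hgood : EdgeGood k c s q) {Rlo : ℝ} (hRlo : 0 < Rlo) (R C : ℝ) (Dn : ℕ) :
    {N : ℕ | 3 ≤ N ∧ 4 * q ≤ N ∧ ∃ r W : ℚ, W ≠ 0 ∧ W = r * 2 ^ (s * (N ! / q)) ∧
      bev (xPolyP k c) (partialSum 2 N) r = 0 ∧ Rlo ≤ ‖(W : PadicAlgCl 2)‖ ∧ ‖(W : PadicAlgCl 2)‖ ≤ R ∧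
      W.den ≤ Dn ∧ |(W : ℝ)| ≤ C * 2 ^ (s * (N ! / q))}.Finite := by
  classical
  obtain ⟨M, hT, hroots⟩ := hgood
  have hf0 : layerPoly k c s q M 0 ≠ 0 := hT.2
  set f := layerPoly k c s q M 0 with hfdef
  set B₀ : ℝ := (max 1 R) ^ dMax k c with hB₀
  have hB₀1 : 1 ≤ B₀ := one_le_pow₀ (le_max_left _ _)
  -- common facts about a member `N` of the set (depth-1 edge bound)
  have hmem : ∀ N : ℕ, ∀ r W : ℚ, 3 ≤ N → 4 * q ≤ N → W = r * 2 ^ (s * (N ! / q)) →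
      bev (xPolyP k c) (partialSum 2 N) r = 0 → ‖(W : PadicAlgCl 2)‖ ≤ R →
      N ! = q * (N ! / q) ∧ (max 1 ‖(W : PadicAlgCl 2)‖) ^ dMax k c ≤ B₀ ∧
      ‖aeval (W : PadicAlgCl 2) f‖ ≤ 2 * B₀ * (1 / 2 : ℝ) ^ (N - 1)! := by
    intro N r W hN3 hN4 hrW hP hWR
    have hqN : q ≤ N := le_trans (Nat.le_mul_of_pos_left q (by norm_num)) hN4
    have hn : N ! = q * (N ! / q) := (Nat.mul_div_cancel' (Nat.dvd_factorial hq hqN)).symm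
    have h1 := edge_bound_one k c hT hN3 hn hrW hP
    have hBW : (max 1 ‖(W : PadicAlgCl 2)‖) ^ dMax k c ≤ B₀ :=
      pow_le_pow_left₀ (by positivity) (max_le_max le_rfl hWR) _
    have hpos : (0 : ℝ) ≤ (1 / 2 : ℝ) ^ (1 * (N ! / q)) + (1 / 2 : ℝ) ^ (Nat.factorial N - Nat.factorial (N - 1)) := by
      positivity
    have h3 := crude_bound hq hqN (by omega) hn one_pos
    refine ⟨hn, hBW, (h1.trans (mul_le_mul_of_nonneg_right hBW hpos)).trans ?_⟩
    calc B₀ * ((1 / 2 : ℝ) ^ (1 * (N ! / q)) + (1 / 2 : ℝ) ^ (Nat.factorial N - Nat.factorial (N - 1)))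
        ≤ B₀ * (2 * (1 / 2 : ℝ) ^ (N - 1)!) := mul_le_mul_of_nonneg_left h3 (by positivity)
      _ = 2 * B₀ * (1 / 2 : ℝ) ^ (N - 1)! := by ring
  by_cases hdeg : f.natDegree = 0
  · -- a constant non-zero edge polynomial: no member beyond a threshold
    have hfC : f = Polynomial.C (f.coeff 0) := eq_C_of_natDegree_eq_zero hdeg
    have ha0 : f.coeff 0 ≠ 0 := by
      intro h; apply hf0; rw [hfC, h, Polynomial.C_0]
    set α : ℝ := ‖((f.coeff 0 : ℤ) : PadicAlgCl 2)‖ with hαdef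
    have hα : 0 < α := norm_pos_iff.mpr (by exact_mod_cast ha0)
    have hval : ∀ z : PadicAlgCl 2, aeval z f = ((f.coeff 0 : ℤ) : PadicAlgCl 2) := by
      intro z
      calc aeval z f = aeval z (Polynomial.C (f.coeff 0)) := by rw [← hfC]
        _ = ((f.coeff 0 : ℤ) : PadicAlgCl 2) := by rw [aeval_C]; exact map_intCast _ _
    obtain ⟨N₀, hN₀⟩ := eventually_small (2 * B₀) α hα
    refine (Set.finite_lt_nat N₀).subset ?_
    rintro N ⟨hN3, hN4, r, W, -, hrW, hP, -, hWR, -, -⟩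
    rw [Set.mem_setOf_eq]
    by_contra hge
    push Not at hge
    obtain ⟨-, -, hsmall⟩ := hmem N r W hN3 hN4 hrW hP hWR
    rw [hval] at hsmall
    have := hN₀ N hge
    linarith
  · -- roots: the nearest-root inequality, then per root
    have h1 : 1 ≤ f.natDegree := Nat.one_le_iff_ne_zero.mpr hdeg
    obtain ⟨T, nβ, c₀, hc₀, hTroot, hn1, hnmult, -, -, hnear⟩ := nearest_root_sharp f h1
    obtain ⟨N₂, hN₂⟩ := eventually_small (c₀ * (2 * B₀)) 1 one_pos
    set Sβ : PadicAlgCl 2 → Set ℕ := fun β => {N : ℕ | 3 ≤ N ∧ 4 * q ≤ N ∧ ∃ r W : ℚ, W ≠ 0 ∧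
      W = r * 2 ^ (s * (N ! / q)) ∧ bev (xPolyP k c) (partialSum 2 N) r = 0 ∧ Rlo ≤ ‖(W : PadicAlgCl 2)‖ ∧
      ‖(W : PadicAlgCl 2)‖ ≤ R ∧ W.den ≤ Dn ∧ |(W : ℝ)| ≤ C * 2 ^ (s * (N ! / q)) ∧
      ‖(W : PadicAlgCl 2) - β‖ ^ nβ β ≤ c₀ * ‖aeval (W : PadicAlgCl 2) f‖}
      with hSβ
    have hcover : {N : ℕ | 3 ≤ N ∧ 4 * q ≤ N ∧ ∃ r W : ℚ, W ≠ 0 ∧ W = r * 2 ^ (s * (N ! / q)) ∧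
        bev (xPolyP k c) (partialSum 2 N) r = 0 ∧ Rlo ≤ ‖(W : PadicAlgCl 2)‖ ∧ ‖(W : PadicAlgCl 2)‖ ≤ R ∧
        W.den ≤ Dn ∧ |(W : ℝ)| ≤ C * 2 ^ (s * (N ! / q))} ⊆ {N | N < N₂} ∪ ⋃ β ∈ T, Sβ β := by
      rintro N ⟨hN3, hN4, r, W, hW0, hrW, hP, hWlo, hWR, hden, habs⟩
      by_cases hlt : N < N₂
      · exact Or.inl hlt
      right
      push Not at hlt
      obtain ⟨hn, -, hsmall⟩ := hmem N r W hN3 hN4 hrW hP hWR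
      obtain ⟨β, hβT, hβ⟩ := hnear (W : PadicAlgCl 2)
      have hlt1 : ‖(W : PadicAlgCl 2) - β‖ < 1 := by
        by_contra hge1
        push Not at hge1
        rw [min_eq_left hge1, one_pow] at hβ
        have h2 : c₀ * ‖aeval (W : PadicAlgCl 2) f‖ ≤ c₀ * (2 * B₀ * (1 / 2 : ℝ) ^ (N - 1)!) :=
          mul_le_mul_of_nonneg_left hsmall hc₀.le
        have h3 := hN₂ N hlt
        linarith
      rw [min_eq_right hlt1.le] at hβ
      exact Set.mem_biUnion hβT ⟨hN3, hN4, r, W, hW0, hrW, hP, hWlo, hWR, hden, habs, hβ⟩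
    refine Set.Finite.subset (Set.Finite.union (Set.finite_lt_nat N₂)
      (Set.Finite.biUnion T.finite_toSet fun β hβT => ?_)) hcover
    -- finiteness of `Sβ β`; first: a uniform lower bound `δ ≤ ‖W − β‖` on members makes it finite
    have hlow : ∀ δ : ℝ, 0 < δ → (∀ N ∈ Sβ β, ∀ r W : ℚ, W = r * 2 ^ (s * (N ! / q)) →
        bev (xPolyP k c) (partialSum 2 N) r = 0 → Rlo ≤ ‖(W : PadicAlgCl 2)‖ → δ ≤ ‖(W : PadicAlgCl 2) - β‖) →
        (Sβ β).Finite := by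
      intro δ hδ hδle
      obtain ⟨N₃, hN₃⟩ := eventually_small (c₀ * (2 * B₀)) (δ ^ nβ β) (pow_pos hδ _)
      refine (Set.finite_lt_nat N₃).subset ?_
      intro N hN
      obtain ⟨hN3, hN4, r, W, -, hrW, hP, hWlo, hWR, -, -, hβW⟩ := id hN
      rw [Set.mem_setOf_eq]
      by_contra hge
      push Not at hge
      obtain ⟨-, -, hsmall⟩ := hmem N r W hN3 hN4 hrW hP hWR
      have h1 : δ ^ nβ β ≤ ‖(W : PadicAlgCl 2) - β‖ ^ nβ β :=
        pow_le_pow_left₀ hδ.le (hδle N hN r W hrW hP hWlo) _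
      have h2 := mul_le_mul_of_nonneg_left hsmall hc₀.le
      have h3 := hN₃ N hge
      linarith
    by_cases hβ0 : β = 0
    · -- `β = 0` is never nearest: `‖W‖ ≥ Rlo`
      exact hlow Rlo hRlo fun N _ r W _ _ hWlo => by rw [hβ0, sub_zero]; exact hWlo
    have hβZ : IsAlgebraic ℤ β := ⟨f, hf0, hTroot β hβT⟩
    have hβalg : IsAlgebraic ℚ β := hβZ.extendScalars (RingHom.injective_int (algebraMap ℤ ℚ))
    rcases hroots β hβ0 (hTroot β hβT) with hirr | ⟨L, hlay, hμL, hμq⟩ | ⟨hder, L, hlay, hsL, hsq⟩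
    · -- (I) `β` outside `ℚ₂`
      obtain ⟨δ, hδ, hδle⟩ := exists_pos_le_norm_ratCast_sub β hirr
      exact hlow δ hδ fun N _ r W _ _ _ => hδle W
    · -- (C) crude: layers `1 … L−1` vanish identically; Ridout with exponent `μ = μ_β`
      set μ : ℕ := nβ β with hμdef
      have hμ1 : 1 ≤ μ := hn1 β hβT
      have hμeq : rootMult f β = μ := (hnmult β).symm
      rw [hμeq] at hμL hμq
      have hL1 : 1 ≤ L := by omega
      refine (ridout_levels_finite k c hB hs hq hβalg hμ1 hμL hμq (A := c₀ * B₀) (by positivity) C Dn).subset ?_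
      rintro N ⟨hN3, hN4, r, W, hW0, hrW, hP, hWlo, hWR, hden, habs, hβW⟩
      obtain ⟨hn, hBW, -⟩ := hmem N r W hN3 hN4 hrW hP hWR
      have hfW := edge_bound_crude k c hT hL1 hlay hN3 hn hrW hP
      have hpos : (0 : ℝ) ≤ (1 / 2 : ℝ) ^ (L * (N ! / q)) + (1 / 2 : ℝ) ^ (Nat.factorial N - Nat.factorial (N - 1)) := by
        positivity
      refine ⟨hN4, r, W, hW0, hrW, hP, hden, habs, hβW.trans ?_⟩
      rw [mul_assoc]
      exact mul_le_mul_of_nonneg_left (hfW.trans (mul_le_mul_of_nonneg_right hBW hpos)) hc₀.le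
    · -- (R) refined: `β` simple, layers `1 … L−1` vanish AT `β` and are absorbed; Ridout with exponent `1`
      have hL1 : 1 ≤ L := by omega
      obtain ⟨κ, ρ, hκ, hρ, hexact⟩ := refined_root f (hTroot β hβT) hder R
      -- the Lipschitz constants of the layers on the ball `max R ‖β‖`
      set R' : ℝ := max R ‖β‖ with hR'
      set Λ : ℝ := ∑ g ∈ Finset.range L, lipC ((layerPoly k c s q M g).map (algebraMap ℤ (PadicAlgCl 2))) R'
        with hΛ
      have hΛ0 : 0 ≤ Λ := Finset.sum_nonneg fun g _ => lipC_nonneg _ _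
      have hΛg : ∀ g ∈ Finset.range L,
          lipC ((layerPoly k c s q M g).map (algebraMap ℤ (PadicAlgCl 2))) R' ≤ Λ := fun g hg => by
        rw [hΛ]
        exact Finset.single_le_sum (f := fun g =>
          lipC ((layerPoly k c s q M g).map (algebraMap ℤ (PadicAlgCl 2))) R') (fun g _ => lipC_nonneg _ _) hg
      -- thresholds: `‖W − β‖ < ρ` and `Λ·(1/2)^{n} < κ`
      obtain ⟨N₅, hN₅⟩ := eventually_small (c₀ * (2 * B₀)) ((min ρ 1) ^ nβ β) (pow_pos (by positivity) _)
      obtain ⟨N₆, hN₆⟩ := eventually_small Λ κ hκ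
      have hs1 : 1 * s + 1 ≤ L := by omega
      have hq1 : 1 * s + 1 ≤ q := by omega
      refine ((Set.finite_lt_nat (N₅ + N₆)).union (ridout_levels_finite k c hB hs hq hβalg one_pos hs1 hq1
        (A := B₀ / κ) (by positivity) C Dn)).subset ?_
      rintro N ⟨hN3, hN4, r, W, hW0, hrW, hP, hWlo, hWR, hden, habs, hβW⟩
      by_cases hlt : N < N₅ + N₆
      · exact Or.inl hlt
      right
      push Not at hlt
      obtain ⟨hn, hBW, hsmall⟩ := hmem N r W hN3 hN4 hrW hP hWR
      set n : ℕ := N ! / q with hndef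
      -- `‖W − β‖ < ρ`
      have hWβ : ‖(W : PadicAlgCl 2) - β‖ < ρ := by
        have h2 : ‖(W : PadicAlgCl 2) - β‖ ^ nβ β < (min ρ 1) ^ nβ β := by
          have := hN₅ N (by omega)
          have h3 := mul_le_mul_of_nonneg_left hsmall hc₀.le
          linarith
        exact (lt_of_pow_lt_pow_left₀ _ (by positivity) h2).trans_le (min_le_left _ _)
      have hfWeq := hexact (W : PadicAlgCl 2) hWR hWβ
      -- the layered bound at depth `L`, split into the edge term and the absorbed layers
      have hlb := layered_bound k c hT L hN3 hn hrW hP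
      set S : PadicAlgCl 2 := ∑ g ∈ Finset.range L \ {0},
        (2 : PadicAlgCl 2) ^ (n * g) * aeval (W : PadicAlgCl 2) (layerPoly k c s q M g) with hSdef
      have hsplit : ∑ g ∈ Finset.range L, (2 : PadicAlgCl 2) ^ (n * g) * aeval (W : PadicAlgCl 2) (layerPoly k c s q M g)
          = aeval (W : PadicAlgCl 2) f + S := by
        rw [hSdef, ← Finset.add_sum_erase _ _ (Finset.mem_range.mpr (by omega) : 0 ∈ Finset.range L),
          mul_zero, pow_zero, one_mul, Finset.sdiff_singleton_eq_erase]
      have hS : ‖S‖ ≤ (1 / 2 : ℝ) ^ n * Λ * ‖(W : PadicAlgCl 2) - β‖ := by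
        apply IsUltrametricDist.norm_sum_le_of_forall_le_of_nonneg (by positivity)
        intro g hg
        rw [Finset.mem_sdiff, Finset.mem_singleton] at hg
        obtain ⟨hgL, hg0⟩ := hg
        have hg1 : 1 ≤ g := Nat.one_le_iff_ne_zero.mpr hg0
        have hvan : ((layerPoly k c s q M g).map (algebraMap ℤ (PadicAlgCl 2))).eval β = 0 := by
          rw [← aeval_eq_eval_map]; exact hlay g hg1 (Finset.mem_range.mp hgL)
        have hlip := norm_eval_sub_le ((layerPoly k c s q M g).map (algebraMap ℤ (PadicAlgCl 2)))
          (hWR.trans (le_max_left R ‖β‖)) (le_max_right R ‖β‖)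
        rw [hvan, sub_zero, ← aeval_eq_eval_map] at hlip
        rw [norm_mul, norm_two_pow_Cp]
        have h2 : (1 / 2 : ℝ) ^ (n * g) ≤ (1 / 2 : ℝ) ^ n :=
          pow_le_pow_of_le_one (by norm_num) (by norm_num) (Nat.le_mul_of_pos_right n (by omega))
        calc (1 / 2 : ℝ) ^ (n * g) * ‖aeval (W : PadicAlgCl 2) (layerPoly k c s q M g)‖
            ≤ (1 / 2 : ℝ) ^ n * (‖(W : PadicAlgCl 2) - β‖ * Λ) :=
              mul_le_mul h2 (hlip.trans (mul_le_mul_of_nonneg_left (hΛg g hgL) (norm_nonneg _)))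
                (norm_nonneg _) (by positivity)
          _ = (1 / 2 : ℝ) ^ n * Λ * ‖(W : PadicAlgCl 2) - β‖ := by ring
      -- `(1/2)^n · Λ < κ`
      have hnΛ : (1 / 2 : ℝ) ^ n * Λ < κ := by
        have h2 : (1 / 2 : ℝ) ^ n ≤ (1 / 2 : ℝ) ^ (N - 1)! :=
          pow_le_pow_of_le_one (by norm_num) (by norm_num) (factorial_pred_le_div hq hN4)
        have h3 := hN₆ N (by omega)
        nlinarith
      -- absorb: `κ‖W − β‖ = ‖f(W)‖ ≤ max(‖f(W) + S‖, ‖S‖)`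
      have hkey : ‖(W : PadicAlgCl 2) - β‖ ≤
          B₀ / κ * ((1 / 2 : ℝ) ^ (L * n) + (1 / 2 : ℝ) ^ (Nat.factorial N - Nat.factorial (N - 1))) := by
        have hpos : (0 : ℝ) ≤ (1 / 2 : ℝ) ^ (L * n) + (1 / 2 : ℝ) ^ (Nat.factorial N - Nat.factorial (N - 1)) := by
          positivity
        have hult : ‖aeval (W : PadicAlgCl 2) f‖ ≤ max ‖aeval (W : PadicAlgCl 2) f + S‖ ‖S‖ := by
          have := IsUltrametricDist.norm_add_le_max (aeval (W : PadicAlgCl 2) f + S) (-S)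
          rwa [add_neg_cancel_right, norm_neg] at this
        rw [← hsplit] at hult
        rcases le_max_iff.mp hult with h | h
        · -- the edge term is bounded by the layered bound
          rw [hfWeq] at h
          have h2 := h.trans (hlb.trans (mul_le_mul_of_nonneg_right hBW hpos))
          rw [div_mul_eq_mul_div, le_div_iff₀ hκ, mul_comm]
          exact h2
        · -- the absorbed case forces `W = β`
          rw [hfWeq] at h
          have h2 : (κ - (1 / 2 : ℝ) ^ n * Λ) * ‖(W : PadicAlgCl 2) - β‖ ≤ 0 := by nlinarith [hS]
          have h3 : ‖(W : PadicAlgCl 2) - β‖ ≤ 0 :=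
            nonpos_of_mul_nonpos_right (by nlinarith [h2]) (by linarith)
          exact h3.trans (by positivity)
      refine ⟨hN4, r, W, hW0, hrW, hP, hden, habs, ?_⟩
      rw [pow_one]
      exact hkey

/-! ## §8  Assembly: the size regime, the denominator of the rescaled point, THE SECTOR THEOREM -/

/-- Gauss at the odd places transported: `a ∣ ℓ·2^t ⟹ a ∣ ℓ·2^{v₂(a)}`. -/
theorem dvd_lc_pow_val {a : ℕ} (ha : a ≠ 0) {ℓ : ℤ} {t : ℕ} (h : (a : ℤ) ∣ ℓ * 2 ^ t) :
    (a : ℤ) ∣ ℓ * 2 ^ padicValNat 2 a := by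
  set v := padicValNat 2 a with hv
  obtain ⟨q', hq'⟩ : 2 ^ v ∣ a := pow_padicValNat_dvd
  have hq'odd : ¬ 2 ∣ q' := by
    intro h2
    have : 2 ^ (v + 1) ∣ a := by rw [hq', pow_succ]; exact Nat.mul_dvd_mul_left _ h2
    exact absurd this (pow_succ_padicValNat_not_dvd ha)
  have hqd : (q' : ℤ) ∣ (a : ℤ) := ⟨2 ^ v, by rw [hq']; push_cast; ring⟩
  have h2 : (q' : ℤ) ∣ 2 ^ t * ℓ := by rw [mul_comm]; exact hqd.trans h
  have hcop : IsCoprime (q' : ℤ) ((2 : ℤ) ^ t) := by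
    apply IsCoprime.pow_right
    rw [Int.isCoprime_iff_gcd_eq_one, show ((q' : ℤ)).gcd 2 = Nat.gcd q' 2 from Int.gcd_natCast_natCast q' 2]
    exact ((Nat.Prime.coprime_iff_not_dvd Nat.prime_two).mpr hq'odd).symm
  have h3 : (q' : ℤ) ∣ ℓ := hcop.dvd_of_dvd_mul_left h2
  rw [hq']
  push_cast
  rw [mul_comm ℓ]
  exact mul_dvd_mul_left _ h3

/-- the size form: `den W ∣ ℓ · 2^{v₂(den W)}` and `‖W‖₂ ≤ R` give `den W ≤ max(1, R)·|ℓ|`. -/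
theorem den_le_of_dvd {W : ℚ} {ℓ : ℤ} (hℓ : ℓ ≠ 0) (hdvd : (W.den : ℤ) ∣ ℓ * 2 ^ padicValNat 2 W.den) {R : ℝ}
    (hWR : ‖(W : PadicAlgCl 2)‖ ≤ R) : (W.den : ℝ) ≤ max 1 R * |(ℓ : ℝ)| := by
  have hle : (W.den : ℤ) ≤ |ℓ * 2 ^ padicValNat 2 W.den| :=
    Int.le_of_dvd (abs_pos.mpr (mul_ne_zero hℓ (pow_ne_zero _ two_ne_zero))) ((dvd_abs _ _).mpr hdvd)
  rw [abs_mul, abs_of_nonneg (by positivity : (0 : ℤ) ≤ 2 ^ padicValNat 2 W.den)] at hle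
  have hle' : (W.den : ℝ) ≤ |(ℓ : ℝ)| * (2 : ℝ) ^ padicValNat 2 W.den := by
    have := (Int.cast_le (R := ℝ)).mpr hle
    push_cast at this
    exact this
  have h2t : (2 : ℝ) ^ padicValNat 2 W.den ≤ max 1 R := by
    rcases Nat.eq_zero_or_pos (padicValNat 2 W.den) with ht0 | htpos
    · rw [ht0, pow_zero]; exact le_max_left _ _
    · rw [← norm_ratCast_of_le htpos]; exact hWR.trans (le_max_right _ _)
  calc (W.den : ℝ) ≤ |(ℓ : ℝ)| * (2 : ℝ) ^ padicValNat 2 W.den := hle'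
    _ ≤ |(ℓ : ℝ)| * max 1 R := mul_le_mul_of_nonneg_left h2t (abs_nonneg _)
    _ = max 1 R * |(ℓ : ℝ)| := mul_comm _ _

/-- **denominator of the rescaled point**: for a level point `r` under dominance and `W = r · 2^e` with
`‖W‖₂ ≤ R`, `den W ≤ max(1,R) · |lc(c₀)|` (Gauss at the odd places; the place `2` read off `‖W‖₂`). -/
theorem den_rescaled_le (k : ℕ) (c : ℕ → ℤ[X]) (hdom : DomZero k c) (h0 : c 0 ≠ 0) {N : ℕ} {r : ℚ}
    (hP : bev (xPolyP k c) (partialSum 2 N) r = 0) {W : ℚ} {e : ℕ} (hW : W = r * 2 ^ e) {R : ℝ}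
    (hWR : ‖(W : PadicAlgCl 2)‖ ≤ R) : (W.den : ℝ) ≤ max 1 R * |((c 0).leadingCoeff : ℝ)| := by
  have hlc : (c 0).leadingCoeff ≠ 0 := leadingCoeff_ne_zero.mpr h0
  have h1 := den_dvd_of_level k c hdom h0 hP
  have hWd : (W.den : ℤ) ∣ (r.den : ℤ) := by
    have h2 : W = r * ((2 ^ e : ℤ) : ℚ) := by rw [hW]; push_cast; ring
    have h3 := Rat.mul_den_dvd r ((2 ^ e : ℤ) : ℚ)
    rw [← h2, Rat.den_intCast, mul_one] at h3
    exact_mod_cast h3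
  exact den_le_of_dvd hlc (dvd_lc_pow_val W.den_nz (hWd.trans h1)) hWR

end Summit.Schanuel.Schanuel.Theorems.RootDecomp1KSectorTheorem
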